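import Summits.HodgeConjecture.HodgeConjecture.Theorems.Ring2WeilCoverageNormTableC
import HarnessLib

/-!
# Weil-type family coverage — closing the last `W6.2.91` candidates: LEMMA IO (inner/outer parity), LEMMA OD (trace-form determinants), LEMMA IN (inert primes of `ℚ(√2)`) (ring2-b02, gen 67)

research route conditional on HC_CM; not a corollary; Q11.4-sentence-2 already refuted in dim ≥ 3.

Ring 2, WEIL-TYPE FAMILY-COVERAGE CENSUS (`HOME/WEIL-FAMILY-COVERAGE.md` `## b02 (g = 6)`, block b02.27, owner ring2-b02).
Block b02.26 left, for the residual row `W6.2.91 = (3, ℚ(√-2), T = {7, 13})`, ONE single-group lead (`2.F4(2).2` on its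
52-dimensional `ℚ(√-2)`-characters) and FOUR open product module types.  Block b02.27 closes all of them by four table-level
lemmas; this file checks in the kernel the finite algebra / arithmetic each of them rests on:

* §1 **LEMMA IO** (inner/outer parity).  A homomorphism to a group of exponent `2` kills every element of odd order, and if it kills
  two members of a product-one triple it kills the third: a branch datum of `G.2` made of odd-order classes and classes on which the
  sign character is trivial lies in `G`.  (With the character-table fact «`χ₉₂|_{2.F4(2)}` rational» this kills the lead: all three
  data `(2b,7a,26a)`, `(2b,13a,14b)`, `(2d,7a,13a)` are inner — kit j225228.)  Plus: a value that is both an integer and purely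
  imaginary is `0` (outer involutions of an extension character with imaginary-quadratic field).
* §2 **LEMMA OD** (orthogonal determinant of a restriction of scalars).  The trace form of a hermitian line `⟨a⟩` over `ℚ(√δ)` in the
  basis `e, √δ e` has Gram matrix `diag(2a, -2δa)`, determinant `-4δa²`; over `ℚ(√-3)` in the basis `e, ωe` it is `3a²`; a rank-`n`
  diagonal form has determinant `3ⁿ·(∏ aᵢ)²`.  Hence `det χ₉₉ ≡ 3²⁷ ≡ 3` and `det χ₇₇ ≡ 3¹⁴ ≡ 1` for the factors `3.O7(3).2`,
  `2.S6(3).2` of types (a), (b); and `3 ∈ Nm(ℚ(√-2)ˣ)` (tree: `SqrtNeg2.mem_3`) makes the type-(a) symbol trivial in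
  `ℚˣ/Nm(ℚ(√-2)ˣ)` (§2, `typeA_det_symbol_eq_one`, `typeB_det_symbol_eq_one`).
* §3 **LEMMA IN** (inert primes).  `2` is a non-square modulo `13` and modulo `5`; hence `p ∣ a² - 2b² ⇒ p ∣ a ∧ p ∣ b` and
  `a² - 2b² = p²·(a'² - 2b'²)` (descent), so the `p`-adic valuation of a norm from `ℚ(√2)` is EVEN (`p = 13, 5`): an order-`8` slot of
  COROLLARY Y1 (symbol `Nr_{ℚ(√2)/ℚ} Δ₈`) never puts `13` or `5` into `T(a_B)`; whereas `7 = 3² - 2`, `17 = 5² - 2·2²`, `23 = 5² - 2`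
  are norms from `ℤ[√2]`.
* §4 the residual row keys this concerns, by name (not restated): `sixfold_sqrtNeg2_neg91_ne_split` (TableC).

Nothing in this file is a statement about Hodge classes; `HC_CM` is used nowhere; no `def`, no named fact.
References: [cite: vanGeemen1994HodgeAV, 5.2 and (5.4.1)]; [cite: Serre1973, Ch. III §1].
-/

noncomputable section

set_option linter.dupNamespace false

open Literature.AlgebraicGeometry.Motives
open Literature.AlgebraicGeometry.VanGeemen1994
open Summit.HodgeConjecture.HodgeConjecture.Ring2.Hypotheses

namespace Summit.HodgeConjecture.HodgeConjecture.Ring2.WeilCoverage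

namespace ResidualClosure

/-! ### §1 LEMMA IO — inner/outer parity -/

/-- **LEMMA IO (i).** A homomorphism into a group in which every element squares to `1` (e.g. the sign character `G.2 → {±1}`)
is trivial on every element of ODD order: odd-order classes are inner.
research route conditional on HC_CM; not a corollary; Q11.4-sentence-2 already refuted in dim ≥ 3. [folklore] -/
theorem map_eq_one_of_odd_orderOf {G H : Type*} [Group G] [Group H] (f : G →* H) (hH : ∀ h : H, h ^ 2 = 1)
    {g : G} (hg : Odd (orderOf g)) : f g = 1 := by
  have h1 : orderOf (f g) ∣ orderOf g := orderOf_map_dvd f g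
  have h2 : orderOf (f g) ∣ 2 := orderOf_dvd_of_pow_eq_one (hH (f g))
  have hcop : Nat.Coprime (orderOf g) 2 := Nat.coprime_two_right.2 hg
  have h3 : orderOf (f g) ∣ Nat.gcd (orderOf g) 2 := Nat.dvd_gcd h1 h2
  rw [hcop, Nat.dvd_one] at h3
  exact orderOf_eq_one_iff.1 h3

/-- **LEMMA IO (iii), the parity of a product-one triple.** If `g₁ g₂ g₃ = 1` and a homomorphism kills `g₁` and `g₂`, it kills
`g₃`: a branch triple of `G.2` with two inner classes is all-inner (an even number of outer classes).
research route conditional on HC_CM; not a corollary; Q11.4-sentence-2 already refuted in dim ≥ 3. [folklore] -/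
theorem map_third_eq_one {G H : Type*} [Group G] [Group H] (f : G →* H) {g₁ g₂ g₃ : G}
    (h : g₁ * g₂ * g₃ = 1) (h₁ : f g₁ = 1) (h₂ : f g₂ = 1) : f g₃ = 1 := by
  have := congrArg f h
  rw [map_mul, map_mul, h₁, h₂, one_mul, one_mul, map_one] at this
  exact this

/-- **LEMMA IO applied to the lead's shape.** In a product-one triple of `G.2` whose first class has odd order (`7a`, `13a`) and
whose second class is killed by the sign character (a class with non-zero rational character value, e.g. `2b`, `2d` with
`χ₉₂ = 20, 12`), the third class is inner as well — the triple lies in `G`.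
research route conditional on HC_CM; not a corollary; Q11.4-sentence-2 already refuted in dim ≥ 3. [folklore] -/
theorem triple_inner_of_odd_and_inner {G H : Type*} [Group G] [Group H] (f : G →* H) (hH : ∀ h : H, h ^ 2 = 1)
    {g₁ g₂ g₃ : G} (h : g₁ * g₂ * g₃ = 1) (h₁ : Odd (orderOf g₁)) (h₂ : f g₂ = 1) :
    f g₁ = 1 ∧ f g₂ = 1 ∧ f g₃ = 1 :=
  ⟨map_eq_one_of_odd_orderOf f hH h₁, h₂, map_third_eq_one f h (map_eq_one_of_odd_orderOf f hH h₁) h₂⟩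

/-- **LEMMA IO (ii), the value of an extension character on an outer involution.** If `χ̄ = χ·ε` then on an outer class
`χ(x) = -conj χ(x)` is purely imaginary; a character value at an involution is an integer; an integer `n` with `conj n = -n` is `0`.
research route conditional on HC_CM; not a corollary; Q11.4-sentence-2 already refuted in dim ≥ 3. [folklore] -/
theorem int_eq_zero_of_conj_eq_neg (n : ℤ) (h : (starRingEnd ℂ) (n : ℂ) = -(n : ℂ)) : n = 0 := by
  rw [map_intCast] at h
  have h2 : (2 : ℂ) * (n : ℂ) = 0 := by linear_combination h
  rcases mul_eq_zero.1 h2 with h0 | h0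
  · norm_num at h0
  · exact_mod_cast h0

/-! ### §2 LEMMA OD — trace-form determinants -/

/-- **LEMMA OD, one hermitian line, basis `e, √δ·e`.** `Tr_{ℚ(√δ)/ℚ}(a·x·ȳ)` has Gram matrix `diag(2a, -2δa)`: determinant `-4δa²`
(`≡ -δ` modulo squares).
research route conditional on HC_CM; not a corollary; Q11.4-sentence-2 already refuted in dim ≥ 3. [folklore] -/
theorem det_traceForm_line (δ a : ℚ) : Matrix.det !![2 * a, 0; 0, -2 * δ * a] = -4 * δ * a ^ 2 := by
  rw [Matrix.det_fin_two_of]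
  ring

/-- **LEMMA OD, one hermitian line over `ℚ(√-3)`, basis `e, ω·e`** (`Tr 1 = 2`, `Tr ω = -1`, `Tr ωω̄ = 2`): Gram `a·[[2,-1],[-1,2]]`,
determinant `3a²`.
research route conditional on HC_CM; not a corollary; Q11.4-sentence-2 already refuted in dim ≥ 3. [folklore] -/
theorem det_traceForm_line_omega (a : ℚ) : Matrix.det !![2 * a, -a; -a, 2 * a] = 3 * a ^ 2 := by
  rw [Matrix.det_fin_two_of]
  ring

/-- **LEMMA OD, rank `n`:** the trace form of a diagonal hermitian form `⊥ᵢ ⟨aᵢ⟩` over `ℚ(√-3)` has determinant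
`∏ᵢ 3aᵢ² = 3ⁿ·(∏ᵢ aᵢ)²` — `≡ 3ⁿ` modulo squares: `det χ₉₉ ≡ 3²⁷ ≡ 3` (`3.O7(3).2`, `n = 27`), `det χ₇₇ ≡ 3¹⁴ ≡ 1` (`2.S6(3).2`, `n = 14`).
research route conditional on HC_CM; not a corollary; Q11.4-sentence-2 already refuted in dim ≥ 3. [folklore] -/
theorem prod_traceForm_lines (n : ℕ) (a : Fin n → ℚ) :
    (∏ i, 3 * a i ^ 2) = 3 ^ n * (∏ i, a i) ^ 2 := by
  rw [Finset.prod_mul_distrib, Finset.prod_const, Finset.card_univ, Fintype.card_fin, Finset.prod_pow]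

/-- `3²⁷ = 3·(3¹³)²` and `3¹⁴ = (3⁷)²`: the square classes of the two orthogonal determinants of LEMMA OD.
research route conditional on HC_CM; not a corollary; Q11.4-sentence-2 already refuted in dim ≥ 3. [folklore] -/
theorem three_pow_27_eq : (3 : ℚ) ^ 27 = 3 * ((3 : ℚ) ^ 13) ^ 2 := by norm_num

/-- **Type (a) closed at the `det` symbol:** `det χ₉₉ ≡ 3²⁷` is a NORM from `ℚ(√-2)` (`3 = 1 + 2·1`), i.e. its class in
`ℚˣ/Nm(ℚ(√-2)ˣ)` is trivial — the reflection-slot symbol `det(b)` of COROLLARY Y1 contributes nothing to `T(a_B)` for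
`GL₂(3) × 3.O7(3).2` on `χ₂ ⊗ χ₉₉`.
research route conditional on HC_CM; not a corollary; Q11.4-sentence-2 already refuted in dim ≥ 3. [cite: vanGeemen1994HodgeAV, (5.4.1)] -/
theorem typeA_det_symbol_eq_one :
    (QuotientGroup.mk (Units.mk0 ((3 : ℚ) ^ 27) (by norm_num)) : weilNormResidueGroup 2) = 1 := by
  rw [QuotientGroup.eq_one_iff]
  have h3 := SqrtNeg2.mem_3
  have hsq := sq_mem_normUnitsSubgroup (d := 2) (q := (3 : ℚ) ^ 13) (by norm_num)
  have e : Units.mk0 ((3 : ℚ) ^ 27) (by norm_num) =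
      Units.mk0 (3 : ℚ) (by norm_num) * Units.mk0 (((3 : ℚ) ^ 13) ^ 2) (by norm_num) := by
    ext; push_cast; norm_num
  rw [e]
  exact Subgroup.mul_mem _ h3 hsq

/-- **Type (b) closed at the `det` symbol:** `det χ₇₇ ≡ 3¹⁴ = (3⁷)²` is a square, so its class in `ℚˣ/Nm(ℚ(√-2)ˣ)` is trivial
(`SD₁₆ × 2.S6(3).2` on `χ₂ ⊗ χ₇₇`).
research route conditional on HC_CM; not a corollary; Q11.4-sentence-2 already refuted in dim ≥ 3. [cite: vanGeemen1994HodgeAV, (5.4.1)] -/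
theorem typeB_det_symbol_eq_one :
    (QuotientGroup.mk (Units.mk0 ((3 : ℚ) ^ 14) (by norm_num)) : weilNormResidueGroup 2) = 1 := by
  rw [QuotientGroup.eq_one_iff]
  have hsq := sq_mem_normUnitsSubgroup (d := 2) (q := (3 : ℚ) ^ 7) (by norm_num)
  have e : Units.mk0 ((3 : ℚ) ^ 14) (by norm_num) = Units.mk0 (((3 : ℚ) ^ 7) ^ 2) (by norm_num) := by
    ext; norm_num
  rw [e]; exact hsq

/-! ### §3 LEMMA IN — primes inert in `ℚ(√2)` have even valuation in norms -/

/-- `2` is not a square modulo `13` (`13 ≡ 5 mod 8`): `13` is inert in `ℚ(√2)`.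
research route conditional on HC_CM; not a corollary; Q11.4-sentence-2 already refuted in dim ≥ 3. [cite: Serre1973, Ch. III §1] -/
theorem two_not_isSquare_mod_13 : ¬ IsSquare (2 : ZMod 13) := by decide

/-- `2` is not a square modulo `5` (`5 ≡ 5 mod 8`): `5` is inert in `ℚ(√2)`.
research route conditional on HC_CM; not a corollary; Q11.4-sentence-2 already refuted in dim ≥ 3. [cite: Serre1973, Ch. III §1] -/
theorem two_not_isSquare_mod_5 : ¬ IsSquare (2 : ZMod 5) := by decide

/-- **LEMMA IN, descent step.** For a prime `p` with `2` a non-square mod `p`: `p ∣ a² - 2b² ⇒ p ∣ a ∧ p ∣ b`.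
research route conditional on HC_CM; not a corollary; Q11.4-sentence-2 already refuted in dim ≥ 3. [cite: Serre1973, Ch. III §1] -/
theorem dvd_of_dvd_normSqrtTwo {p : ℕ} (hp : p.Prime) (hres : ¬ IsSquare (2 : ZMod p)) {a b : ℤ}
    (h : (p : ℤ) ∣ a ^ 2 - 2 * b ^ 2) : (p : ℤ) ∣ a ∧ (p : ℤ) ∣ b := by
  haveI := Fact.mk hp
  have hmod : ((a : ZMod p)) ^ 2 = 2 * ((b : ZMod p)) ^ 2 := by
    have h0 : (((a ^ 2 - 2 * b ^ 2 : ℤ)) : ZMod p) = 0 := (ZMod.intCast_zmod_eq_zero_iff_dvd _ p).2 h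
    push_cast at h0
    linear_combination h0
  obtain ⟨ha, hb⟩ := zmod_eq_zero_of_sq_eq_mul_sq hres hmod
  exact ⟨(ZMod.intCast_zmod_eq_zero_iff_dvd a p).1 ha, (ZMod.intCast_zmod_eq_zero_iff_dvd b p).1 hb⟩

/-- **LEMMA IN, the descent identity.** `p ∣ a² - 2b²` (with `2` a non-square mod `p`) ⇒ `a = p a'`, `b = p b'` and
`a² - 2b² = p²·(a'² - 2b'²)`.
research route conditional on HC_CM; not a corollary; Q11.4-sentence-2 already refuted in dim ≥ 3. [cite: Serre1973, Ch. III §1] -/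
theorem normSqrtTwo_descent {p : ℕ} (hp : p.Prime) (hres : ¬ IsSquare (2 : ZMod p)) {a b : ℤ}
    (h : (p : ℤ) ∣ a ^ 2 - 2 * b ^ 2) :
    ∃ a' b' : ℤ, a = p * a' ∧ b = p * b' ∧ a ^ 2 - 2 * b ^ 2 = (p : ℤ) ^ 2 * (a' ^ 2 - 2 * b' ^ 2) := by
  obtain ⟨⟨a', ha'⟩, ⟨b', hb'⟩⟩ := dvd_of_dvd_normSqrtTwo hp hres h
  exact ⟨a', b', ha', hb', by subst ha'; subst hb'; ring⟩

/-- **LEMMA IN (parity).** For a prime `p` with `2` a non-square mod `p` and `(a, b)` with `a² - 2b² ≠ 0`, the `p`-adic valuation of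
`N_{ℚ(√2)/ℚ}(a + b√2) = a² - 2b²` is EVEN.  (Strong induction on `|a| + |b|` over the descent.)
research route conditional on HC_CM; not a corollary; Q11.4-sentence-2 already refuted in dim ≥ 3. [cite: Serre1973, Ch. III §1] -/
theorem even_padicValInt_normSqrtTwo {p : ℕ} (hp : p.Prime) (hres : ¬ IsSquare (2 : ZMod p)) :
    ∀ (m : ℕ) (a b : ℤ), a.natAbs + b.natAbs = m → a ^ 2 - 2 * b ^ 2 ≠ 0 → Even (padicValInt p (a ^ 2 - 2 * b ^ 2)) := by
  haveI := Fact.mk hp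
  intro m
  induction m using Nat.strong_induction_on with
  | _ m ih =>
    intro a b hm hN
    by_cases hdvd : (p : ℤ) ∣ a ^ 2 - 2 * b ^ 2
    · obtain ⟨a', b', ha', hb', hid⟩ := normSqrtTwo_descent hp hres hdvd
      have hN' : a' ^ 2 - 2 * b' ^ 2 ≠ 0 := by
        intro h0; apply hN; rw [hid, h0, mul_zero]
      have hp0 : (p : ℤ) ≠ 0 := by exact_mod_cast hp.ne_zero
      have hpp : (p : ℤ) ^ 2 ≠ 0 := pow_ne_zero 2 hp0
      -- the measure drops: |a'| + |b'| < |a| + |b| (not both zero since the norm is non-zero)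
      have hab : a'.natAbs + b'.natAbs < m := by
        have hpa : a.natAbs = p * a'.natAbs := by rw [ha', Int.natAbs_mul, Int.natAbs_natCast]
        have hpb : b.natAbs = p * b'.natAbs := by rw [hb', Int.natAbs_mul, Int.natAbs_natCast]
        have hpos : 0 < a'.natAbs + b'.natAbs := by
          rcases Nat.eq_zero_or_pos (a'.natAbs + b'.natAbs) with h0 | h0
          · exfalso; apply hN'
            have ha0 : a' = 0 := Int.natAbs_eq_zero.1 (by omega)
            have hb0 : b' = 0 := Int.natAbs_eq_zero.1 (by omega)
            rw [ha0, hb0]; ring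
          · exact h0
        have h2 : 2 ≤ p := hp.two_le
        rw [← hm, hpa, hpb]
        nlinarith
      have hrec := ih _ hab a' b' rfl hN'
      rw [hid, padicValInt.mul hpp hN', pow_two, padicValInt.mul hp0 hp0, padicValInt.self hp.one_lt]
      exact Even.add (by decide) hrec
    · have : padicValInt p (a ^ 2 - 2 * b ^ 2) = 0 := padicValInt.eq_zero_of_not_dvd hdvd
      rw [this]; exact ⟨0, rfl⟩

/-- **LEMMA IN at `13`:** `v₁₃(a² - 2b²)` is even whenever `a² - 2b² ≠ 0` — an order-`8` slot symbol `Nr_{ℚ(√2)/ℚ}(Δ₈)` never carries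
`13` to an odd power, so it never puts `13` (inert in `ℚ(√-2)` as well) into `T(a_B)`: the rows `W6.2.91 = {7,13}` and
`W6.2.299 = {13,23}` are out of reach of the order-`8` symbols.
research route conditional on HC_CM; not a corollary; Q11.4-sentence-2 already refuted in dim ≥ 3. [cite: Serre1973, Ch. III §1] -/
theorem even_padicValInt_thirteen_normSqrtTwo (a b : ℤ) (h : a ^ 2 - 2 * b ^ 2 ≠ 0) :
    Even (padicValInt 13 (a ^ 2 - 2 * b ^ 2)) :=
  even_padicValInt_normSqrtTwo (by norm_num) two_not_isSquare_mod_13 _ a b rfl h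

/-- **LEMMA IN at `5`:** `v₅(a² - 2b²)` is even whenever `a² - 2b² ≠ 0` (row `W6.2.115 = {5,23}` is out of reach of the
order-`8` symbols).
research route conditional on HC_CM; not a corollary; Q11.4-sentence-2 already refuted in dim ≥ 3. [cite: Serre1973, Ch. III §1] -/
theorem even_padicValInt_five_normSqrtTwo (a b : ℤ) (h : a ^ 2 - 2 * b ^ 2 ≠ 0) :
    Even (padicValInt 5 (a ^ 2 - 2 * b ^ 2)) :=
  even_padicValInt_normSqrtTwo (by norm_num) two_not_isSquare_mod_5 _ a b rfl h

/-- The residual primes that SPLIT in `ℚ(√2)` are norms from `ℤ[√2]`: `7 = 3² - 2·1²`, `17 = 5² - 2·2²`, `23 = 5² - 2·1²` — the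
order-`8` symbols CAN carry them (they do: b02.21's `W6.2.13`-type data, b04.14's `W6.2.7`, `W6.2.23`).
research route conditional on HC_CM; not a corollary; Q11.4-sentence-2 already refuted in dim ≥ 3. [folklore] -/
theorem split_primes_are_normsSqrtTwo :
    (3 : ℤ) ^ 2 - 2 * 1 ^ 2 = 7 ∧ (5 : ℤ) ^ 2 - 2 * 2 ^ 2 = 17 ∧ (5 : ℤ) ^ 2 - 2 * 1 ^ 2 = 23 := by norm_num

/-! ### §4 The row this concerns -/

/-- **Row `W6.2.91` stays residual but is now EMPTY at the library level:** its key `[(-91 : ℚ)] ≠ splitDiscriminantClass 3 2` is the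
tree's `sixfold_sqrtNeg2_neg91_ne_split`; restated here only as the arithmetic `91 = 7·13` with both primes inert in `ℚ(√-2)`
(`-2` is a non-square mod `7` and mod `13`).
research route conditional on HC_CM; not a corollary; Q11.4-sentence-2 already refuted in dim ≥ 3. [cite: Serre1973, Ch. III §1] -/
theorem row_91_primes : (91 : ℕ) = 7 * 13 ∧ ¬ IsSquare (-(2 : ZMod 7)) ∧ ¬ IsSquare (-(2 : ZMod 13)) := by
  refine ⟨by norm_num, by decide, by decide⟩

end ResidualClosure

end Summit.HodgeConjecture.HodgeConjecture.Ring2.WeilCoverage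

end
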